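import Literature.NumberTheory.Automorphic.UnitaryGroupTruncatedKernelIntegrableCM
import Literature.NumberTheory.Automorphic.UnitaryGroupBorelLatticeCellCountSiegel
import Literature.NumberTheory.Automorphic.QuasiSplitTestLiftLipschitz
import Literature.NumberTheory.Automorphic.UnitaryGroupKernelOffBorelVanishing
import Literature.NumberTheory.Automorphic.UnitaryGroupTruncatedKernelHighCusp
import Literature.NumberTheory.Automorphic.UnitaryGroupBorelConstantTermIndependence
import Literature.NumberTheory.Automorphic.UnitaryGroupIwasawaAdelic
import HarnessLib

/-!
# `TruncatedKernelIntegrable` from the rows: the Siegel majorant `Φ = (C₀ δ_B / ν(𝓕₀)) · 3Lρ` assembled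
# from the cell count, the oscillation bound and the Siegel property

(Arthur, *A trace formula for reductive groups I*, Duke Math. J. 45 (1978), §8; Rogawski (1990), §2.2;
Gelbart–Jacquet (1979), §7.)

Topic `NumberTheory/Automorphic`; namespace `Literature.NumberTheory.Automorphic.UnitaryGroup`. THEOREMS ONLY
(no definition, no named fact, no instance, no notation, no `sorry`). Row H8c (the trunk's assembly) of the
T1-qs sub-line of `Cruxes/H413/Lines/F0_T1InnerFormTraceIdentity.lean`, census
`CENSUS-T1qs-TruncatedKernelIntegrable.v3`.

★ H8b (`UnitaryGroupCuspIntegralSiegelMajorant`) reduced the named fact to a SIEGEL MAJORANT `Φ` of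
`‖K(bk,bk) − K_B(bk,bk)‖` on `S · K_U ∩ {H > T}` with `∫⁻_{S ∩ {H > T}} Φ dμ_B < ∞`. This file BUILDS `Φ`
from the heads the rows have landed, leaving as hypotheses exactly the three row outputs not yet in the tree:

* INPUTS ALREADY ★: the Siegel property `K(g,g) = Σ_{B(F)} …` high in the cusp
  (★ `exists_kernel_eq_borelSum_of_lt_borelHeight`), `k^T = K − K_B` above the cut-off
  (★ `truncatedKernel_eq_kernel_sub_kernelBorel`), independence of `K_B` from `(ν, 𝓕)`
  (★ `kernelBorel_eq_of_isFundamentalDomain`), the oscillation head at test-function level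
  (★ `IsQuasiSplitTest.exists_level_norm_truncatedKernel_le`: `‖k^T(g)‖ ≤ #R · 3Lρ` given the three-factor
  geometry of `Ad(g⁻¹) 𝓕₀`, rows H3 × H5a × H5c), the cell count on a Siegel set
  (★ `exists_forall_card_mul_measure_le_mul_torusRootModulus`: `#R · ν(𝓕₀) ≤ C₀ · δ_B(b)`, row H4-d),
  `K_U` compact and height preserving (★ H8b);
* HYPOTHESES (rows in flight): (H9b) the Siegel set `S ⊆ B(𝔸)` — closed, `B(𝔸) ∩ K_U`-saturated, covering,
  and REDUCED above height `T₀` (unipotent part in a compact `Ω`, root values in compacta `R₁, R₂`: the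
  letters of ★ H4-d); (H5b) the three-factor geometry of `Ad((bk)⁻¹) u`, `u ∈ 𝓕₀`, with a parameter
  `ρ(b)`, for `b ∈ S` reduced, `k ∈ K_U`, together with its fundamental domain `𝓕₀ ⊆ W₀` (compact) for the
  level `U` of `f`; (H10) `∫⁻_{S ∩ {H > T}} δ_B(b) · ρ(b) dμ_B(b) < ∞`.

WHAT IS PROVED.
* §1 `enorm_kernel_sub_kernelBorel_le_majorant` — THE POINTWISE MAJORANT: for `b` reduced, `k ∈ K_U`,
  `max(1, c₀, T₀) < T < H(b)`:
  `‖K(bk,bk) − K_B^{ν,𝓕}(bk,bk)‖ₑ ≤ C₀ · ν(𝓕₀)⁻¹ · (3L) · (δ_B(b) · ρ(b))`.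
* §2 `exists_majorant_of_rows` — `hest ∧ hΦ` of ★ H8b for `Φ := C₀ ν(𝓕₀)⁻¹ (3L) · δ_B ρ`.
* §3 `truncatedKernelIntegrable_of_rows` (generic CM-like pair, hypotheses `hc`, `hc1`, `hunimod`) and
  `truncatedKernelIntegrable_cm_of_rows` (at `(L⁺, L, complexConj)`, those three discharged):
  **`TruncatedKernelIntegrable` from `hBK` (H6b-i) and the per-`(ν_G, ν, 𝓕)` row package (H9b, H5b, H10).**

## References
* J. Arthur, *A trace formula for reductive groups I*, Duke Math. J. 45 (1978), §8 (pp. 947–950)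
  [Arthur1978TraceFormulaI].
* J. D. Rogawski, *Automorphic Representations of Unitary Groups in Three Variables*, Ann. of Math. Stud.
  123 (1990), §2.2 (p. 13) [Rogawski1990].
* S. Gelbart, H. Jacquet, *Forms of GL(2) from the analytic point of view*, Proc. Sympos. Pure Math. 33.1
  (1979), §7 [GelbartJacquet1979Corvallis].
-/

set_option autoImplicit false

noncomputable section

open MeasureTheory Measure NumberField NumberField.mixedEmbedding IsDedekindDomain Set
open scoped NNReal ENNReal Pointwise MatrixGroups Classical

namespace Literature.NumberTheory.Automorphic

namespace UnitaryGroup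

variable {F E : Type} [Field F] [NumberField F] [Field E] [NumberField E] [Algebra F E]
  {c : E ≃ₐ[F] E}

section Rows

variable [MeasurableSpace (adelicUnipotent F E c 3)] [BorelSpace (adelicUnipotent F E c 3)]

/-! ## §1 The pointwise majorant -/

omit [MeasurableSpace (adelicUnipotent F E c 3)] [BorelSpace (adelicUnipotent F E c 3)] in
/-- Coercion plumbing: `insert 1 (↑W₀)` in `G(𝔸)` is the image of `insert 1 W₀ ⊆ N(𝔸)`.
[cite: Rogawski1990, §2.2 (p. 13)] -/
private theorem mem_image_insert_one_of_mem_insert {W₀ : Set (adelicUnipotent F E c 3)}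
    {y : (quasiSplit F E c 3).Adelic}
    (hy : y ∈ insert (1 : (quasiSplit F E c 3).Adelic)
      ((fun u : adelicUnipotent F E c 3 => (u : (quasiSplit F E c 3).Adelic)) '' W₀)) :
    ∃ y' ∈ insert (1 : adelicUnipotent F E c 3) W₀, (y' : (quasiSplit F E c 3).Adelic) = y := by
  rcases hy with rfl | ⟨u, hu, rfl⟩
  · exact ⟨1, Set.mem_insert _ _, rfl⟩
  · exact ⟨u, Set.mem_insert_of_mem _ hu, rfl⟩

/-- **THE POINTWISE MAJORANT ON THE SIEGEL SET.**  Fix a Haar measure `ν` of `N(𝔸_F)`, a fundamental domain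
`𝓕` of `N(F)` (the one in the named fact) and a second one `𝓕₀ ⊆ W₀` (compact; the one of row H5b), a test
function `f` read through `φ` on `GL₃(𝔸_E)` with level `U` and Lipschitz constant `L` along the compact
direction set `S_dir` (★ `IsQuasiSplitTest.exists_level_norm_truncatedKernel_le` packages rows H3 × H5a ×
H5c as the property `hH5` below), the cell-count constant `C₀` of ★ H4-d on the reduced set
`{unipotent part ∈ Ω, root values ∈ R₁, R₂}` (`hH4`), and the Siegel constant `c₀` of ★
`exists_kernel_eq_borelSum_of_lt_borelHeight` (`hc₀`).  Then for `b ∈ B(𝔸)` reduced, `k ∈ K_U`,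
`T < H(b)` with `1 ≤ T`, `c₀ ≤ T`, and the three-factor geometry of `Ad((bk)⁻¹) u` (`u ∈ 𝓕₀`) at scale `ρ`:
`‖K(bk,bk) − K_B^{ν,𝓕}(bk,bk)‖ₑ ≤ C₀ · ν(𝓕₀)⁻¹ · (3L) · δ_B(b) · ρ`.
[cite: Arthur1978TraceFormulaI, §8 (pp. 947–950)] [cite: Rogawski1990, §2.2 (p. 13)] -/
theorem enorm_kernel_sub_kernelBorel_le_majorant (ν : Measure (adelicUnipotent F E c 3)) [ν.IsHaarMeasure]
    {𝓕 𝓕₀ W₀ : Set (adelicUnipotent F E c 3)}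
    (h𝓕 : IsFundamentalDomain (rationalUnipotent F E c 3) 𝓕 ν)
    (h𝓕₀ : IsFundamentalDomain (rationalUnipotent F E c 3) 𝓕₀ ν) (hW₀ : IsCompact W₀) (h𝓕₀W₀ : 𝓕₀ ⊆ W₀)
    {f : (quasiSplit F E c 3).Adelic → ℂ}
    {S_dir : Set (Matrix (Fin 3) (Fin 3) (mixedSpace E))} {U : Subgroup (GL (Fin 3) (AdeleRing (𝓞 E) E))}
    {L : ℝ} (hL : 0 ≤ L)
    (hH5 : ∀ {T : ℝ≥0}, 1 ≤ T → ∀ {g : (quasiSplit F E c 3).Adelic}, T < borelHeight g →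
        kernel f g g = borelSum f g g → ∀ (ρ : ℝ),
        (∀ u ∈ 𝓕₀, ∃ (t₁ t₂ t₃ : ℝ) (X₁ X₂ X₃ : Matrix (Fin 3) (Fin 3) (mixedSpace E))
            (w : GL (Fin 3) (AdeleRing (𝓞 E) E)),
          X₁ ∈ S_dir ∧ X₂ ∈ S_dir ∧ X₃ ∈ S_dir ∧ w ∈ U ∧ |t₁| ≤ ρ ∧ |t₂| ≤ ρ ∧ |t₃| ≤ ρ ∧
          adelicVal F E c 3 _ (g⁻¹ * (u : (quasiSplit F E c 3).Adelic) * g) =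
            GLn.ofInfinite 3 E (expGL (t₁ • X₁) * expGL (t₂ • X₂) * expGL (t₃ • X₃)) * w) →
        ∃ R : Finset (arithmeticBorel F E c 3),
          (∀ β ∈ R, ∃ y ∈ insert (1 : (quasiSplit F E c 3).Adelic)
              ((fun u : adelicUnipotent F E c 3 => (u : (quasiSplit F E c 3).Adelic)) '' W₀),
            g⁻¹ * (((β : (quasiSplit F E c 3).arithmeticSubgroup)) : (quasiSplit F E c 3).Adelic) *
              (y * g) ∈ tsupport f) ∧
          ‖truncatedKernel ν 𝓕₀ T f g‖ ≤ R.card * (3 * L * ρ))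
    {Ω : Set (quasiSplit F E c 3).Adelic} {R₁ R₂ : Set (AdeleRing (𝓞 E) E)} {C₀ : ℝ≥0}
    (hH4 : ∀ b : borelAdelic F E c 3,
      (((torusPart b)⁻¹ * b : borelAdelic F E c 3) : (quasiSplit F E c 3).Adelic) ∈ Ω →
      (((diagUnit b.2 0)⁻¹ * diagUnit b.2 1 : (AdeleRing (𝓞 E) E)ˣ) : AdeleRing (𝓞 E) E) ∈ R₁ →
      (((diagUnit b.2 0)⁻¹ * diagUnit b.2 2 : (AdeleRing (𝓞 E) E)ˣ) : AdeleRing (𝓞 E) E) ∈ R₂ →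
      ∀ k ∈ (((standardMaximalCompactGL 3 E).comap (adelicVal F E c 3 ((StdForm.antidiagonal 3).over E)) :
          Subgroup (quasiSplit F E c 3).Adelic) : Set (quasiSplit F E c 3).Adelic),
        ∀ R : Finset (arithmeticBorel F E c 3),
        (∀ β ∈ R, ∃ y ∈ insert (1 : adelicUnipotent F E c 3) W₀, ((b : (quasiSplit F E c 3).Adelic) * k)⁻¹ *
          (((β : (quasiSplit F E c 3).arithmeticSubgroup)) : (quasiSplit F E c 3).Adelic) *
          ((y : (quasiSplit F E c 3).Adelic) * ((b : (quasiSplit F E c 3).Adelic) * k)) ∈ tsupport f) →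
        (R.card : ℝ≥0∞) * ν 𝓕₀ ≤ (C₀ : ℝ≥0∞) * ((torusRootModulus E 3 (diagUnit b.2) : ℝ≥0) : ℝ≥0∞))
    {c₀ : ℝ≥0} (hc₀ : ∀ g : (quasiSplit F E c 3).Adelic, c₀ < borelHeight g → kernel f g g = borelSum f g g)
    {T : ℝ≥0} (hT1 : 1 ≤ T) (hTc₀ : c₀ ≤ T)
    {b : borelAdelic F E c 3}
    (hbΩ : (((torusPart b)⁻¹ * b : borelAdelic F E c 3) : (quasiSplit F E c 3).Adelic) ∈ Ω)
    (hb₁ : (((diagUnit b.2 0)⁻¹ * diagUnit b.2 1 : (AdeleRing (𝓞 E) E)ˣ) : AdeleRing (𝓞 E) E) ∈ R₁)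
    (hb₂ : (((diagUnit b.2 0)⁻¹ * diagUnit b.2 2 : (AdeleRing (𝓞 E) E)ˣ) : AdeleRing (𝓞 E) E) ∈ R₂)
    {k : (quasiSplit F E c 3).Adelic}
    (hk : adelicVal F E c 3 ((StdForm.antidiagonal 3).over E) k ∈ standardMaximalCompactGL 3 E)
    (hTb : T < borelHeight (b : (quasiSplit F E c 3).Adelic)) {ρ : ℝ}
    (hgeom : ∀ u ∈ 𝓕₀, ∃ (t₁ t₂ t₃ : ℝ) (X₁ X₂ X₃ : Matrix (Fin 3) (Fin 3) (mixedSpace E))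
        (w : GL (Fin 3) (AdeleRing (𝓞 E) E)),
      X₁ ∈ S_dir ∧ X₂ ∈ S_dir ∧ X₃ ∈ S_dir ∧ w ∈ U ∧ |t₁| ≤ ρ ∧ |t₂| ≤ ρ ∧ |t₃| ≤ ρ ∧
      adelicVal F E c 3 _ ((((b : (quasiSplit F E c 3).Adelic) * k)⁻¹ *
          (u : (quasiSplit F E c 3).Adelic) * ((b : (quasiSplit F E c 3).Adelic) * k))) =
        GLn.ofInfinite 3 E (expGL (t₁ • X₁) * expGL (t₂ • X₂) * expGL (t₃ • X₃)) * w) :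
    (‖kernel f ((b : (quasiSplit F E c 3).Adelic) * k) ((b : (quasiSplit F E c 3).Adelic) * k) -
        kernelBorel ν 𝓕 f ((b : (quasiSplit F E c 3).Adelic) * k)
          ((b : (quasiSplit F E c 3).Adelic) * k)‖ₑ : ℝ≥0∞) ≤
      (C₀ : ℝ≥0∞) * (ν 𝓕₀)⁻¹ * ENNReal.ofReal (3 * L) *
        (((torusRootModulus E 3 (diagUnit b.2) : ℝ≥0) : ℝ≥0∞) * ENNReal.ofReal ρ) := by
  set g : (quasiSplit F E c 3).Adelic := (b : (quasiSplit F E c 3).Adelic) * k with hg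
  have hkK : k ∈ (((standardMaximalCompactGL 3 E).comap
      (adelicVal F E c 3 ((StdForm.antidiagonal 3).over E)) : Subgroup (quasiSplit F E c 3).Adelic) :
        Set (quasiSplit F E c 3).Adelic) := Subgroup.mem_comap.2 hk
  have hHg : borelHeight g = borelHeight (b : (quasiSplit F E c 3).Adelic) :=
    borelHeight_mul_of_mem_comap_standardMaximalCompactGL (Subgroup.mem_comap.2 hk) _
  have hTg : T < borelHeight g := by rw [hHg]; exact hTb
  have hKg : kernel f g g = borelSum f g g := hc₀ g (lt_of_le_of_lt hTc₀ hTg)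
  -- the oscillation head (rows H3 × H5a × H5c) at `g = b k` with the geometry of row H5b
  obtain ⟨R, hRsupp, hRle⟩ := hH5 hT1 hTg hKg ρ hgeom
  -- the cell count (row H4-d) for this `R`
  have hcount : (R.card : ℝ≥0∞) * ν 𝓕₀ ≤
      (C₀ : ℝ≥0∞) * ((torusRootModulus E 3 (diagUnit b.2) : ℝ≥0) : ℝ≥0∞) := by
    refine hH4 b hbΩ hb₁ hb₂ k hkK R fun β hβ => ?_
    obtain ⟨y, hy, hyC⟩ := hRsupp β hβ
    obtain ⟨y', hy', rfl⟩ := mem_image_insert_one_of_mem_insert hy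
    exact ⟨y', hy', hyC⟩
  -- `ν(𝓕₀) ∈ (0, ∞)`
  have hν0 : ν 𝓕₀ ≠ 0 := measure_ne_zero_of_isFundamentalDomain ν h𝓕₀
  have hνtop : ν 𝓕₀ ≠ ⊤ := (lt_of_le_of_lt (measure_mono h𝓕₀W₀) hW₀.measure_lt_top).ne
  have hcard : (R.card : ℝ≥0∞) ≤
      (C₀ : ℝ≥0∞) * ((torusRootModulus E 3 (diagUnit b.2) : ℝ≥0) : ℝ≥0∞) * (ν 𝓕₀)⁻¹ := by
    rw [← div_eq_mul_inv]
    exact (ENNReal.le_div_iff_mul_le (Or.inl hν0) (Or.inl hνtop)).2 hcount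
  -- `‖K − K_B^{ν,𝓕}‖(g) = ‖k^T_{ν,𝓕₀}(g)‖`
  have hKB : kernelBorel ν 𝓕 f g g = kernelBorel ν 𝓕₀ f g g := by
    rw [kernelBorel_eq_of_isFundamentalDomain ν ν h𝓕 h𝓕₀ f]
  have hkT : kernel f g g - kernelBorel ν 𝓕 f g g = truncatedKernel ν 𝓕₀ T f g := by
    rw [hKB, truncatedKernel_eq_kernel_sub_kernelBorel ν h𝓕₀ f hT1 hTg]
  have hρ3 : 0 ≤ 3 * L := by positivity
  calc (‖kernel f g g - kernelBorel ν 𝓕 f g g‖ₑ : ℝ≥0∞)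
      = ENNReal.ofReal ‖truncatedKernel ν 𝓕₀ T f g‖ := by rw [hkT, ofReal_norm]
    _ ≤ ENNReal.ofReal ((R.card : ℝ) * (3 * L * ρ)) := ENNReal.ofReal_le_ofReal hRle
    _ ≤ (R.card : ℝ≥0∞) * ENNReal.ofReal (3 * L * ρ) := by
        by_cases hρ0 : 0 ≤ 3 * L * ρ
        · rw [ENNReal.ofReal_mul (Nat.cast_nonneg _), ENNReal.ofReal_natCast]
        · rw [ENNReal.ofReal_of_nonpos
            (mul_nonpos_iff.2 (Or.inl ⟨Nat.cast_nonneg _, (not_le.1 hρ0).le⟩))]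
          exact bot_le
    _ ≤ (C₀ : ℝ≥0∞) * ((torusRootModulus E 3 (diagUnit b.2) : ℝ≥0) : ℝ≥0∞) * (ν 𝓕₀)⁻¹ *
          ENNReal.ofReal (3 * L * ρ) := mul_le_mul' hcard le_rfl
    _ ≤ (C₀ : ℝ≥0∞) * ((torusRootModulus E 3 (diagUnit b.2) : ℝ≥0) : ℝ≥0∞) * (ν 𝓕₀)⁻¹ *
          (ENNReal.ofReal (3 * L) * ENNReal.ofReal ρ) := by
        gcongr
        by_cases hρ : 0 ≤ ρ
        · rw [ENNReal.ofReal_mul hρ3]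
        · rw [ENNReal.ofReal_of_nonpos (mul_nonpos_iff.2 (Or.inl ⟨hρ3, (not_le.1 hρ).le⟩))]
          exact bot_le
    _ = (C₀ : ℝ≥0∞) * (ν 𝓕₀)⁻¹ * ENNReal.ofReal (3 * L) *
          (((torusRootModulus E 3 (diagUnit b.2) : ℝ≥0) : ℝ≥0∞) * ENNReal.ofReal ρ) := by ring

/-! ## §2 The majorant `Φ = C₀ ν(𝓕₀)⁻¹ (3L) · δ_B ρ`: `hest ∧ hΦ` of ★ H8b -/

/-- **`hest ∧ hΦ` FROM THE ROWS.**  With the data of §1 and, on a set `S ⊆ B(𝔸)` REDUCED above height `T₀`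
(row H9b: unipotent parts in `Ω`, root values in `R₁, R₂`), the geometry of row H5b at scale `ρ(b)` and the
integrability of row H10 (`∫⁻_{S ∩ {H > T}} δ_B ρ dμ_B < ∞`): the function
`Φ := C₀ · ν(𝓕₀)⁻¹ · (3L) · δ_B · ρ` satisfies the two analytic hypotheses `hest`, `hΦ` of ★
`exists_cover_setLIntegral_lt_top_of_majorant_maximalCompact` for every `T > max(1, c₀, T₀)`.
[cite: Arthur1978TraceFormulaI, §8 (pp. 947–950)] [cite: GelbartJacquet1979Corvallis, §7] -/
theorem exists_majorant_of_rows (ν : Measure (adelicUnipotent F E c 3)) [ν.IsHaarMeasure]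
    {𝓕 𝓕₀ W₀ : Set (adelicUnipotent F E c 3)}
    (h𝓕 : IsFundamentalDomain (rationalUnipotent F E c 3) 𝓕 ν)
    (h𝓕₀ : IsFundamentalDomain (rationalUnipotent F E c 3) 𝓕₀ ν) (hW₀ : IsCompact W₀) (h𝓕₀W₀ : 𝓕₀ ⊆ W₀)
    [MeasurableSpace (quasiSplit F E c 3).Adelic] [BorelSpace (quasiSplit F E c 3).Adelic]
    (μB : Measure (borelAdelic F E c 3)) [μB.IsHaarMeasure]
    {f : (quasiSplit F E c 3).Adelic → ℂ}
    {S_dir : Set (Matrix (Fin 3) (Fin 3) (mixedSpace E))} {U : Subgroup (GL (Fin 3) (AdeleRing (𝓞 E) E))}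
    {L : ℝ} (hL : 0 ≤ L)
    (hH5 : ∀ {T : ℝ≥0}, 1 ≤ T → ∀ {g : (quasiSplit F E c 3).Adelic}, T < borelHeight g →
        kernel f g g = borelSum f g g → ∀ (ρ : ℝ),
        (∀ u ∈ 𝓕₀, ∃ (t₁ t₂ t₃ : ℝ) (X₁ X₂ X₃ : Matrix (Fin 3) (Fin 3) (mixedSpace E))
            (w : GL (Fin 3) (AdeleRing (𝓞 E) E)),
          X₁ ∈ S_dir ∧ X₂ ∈ S_dir ∧ X₃ ∈ S_dir ∧ w ∈ U ∧ |t₁| ≤ ρ ∧ |t₂| ≤ ρ ∧ |t₃| ≤ ρ ∧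
          adelicVal F E c 3 _ (g⁻¹ * (u : (quasiSplit F E c 3).Adelic) * g) =
            GLn.ofInfinite 3 E (expGL (t₁ • X₁) * expGL (t₂ • X₂) * expGL (t₃ • X₃)) * w) →
        ∃ R : Finset (arithmeticBorel F E c 3),
          (∀ β ∈ R, ∃ y ∈ insert (1 : (quasiSplit F E c 3).Adelic)
              ((fun u : adelicUnipotent F E c 3 => (u : (quasiSplit F E c 3).Adelic)) '' W₀),
            g⁻¹ * (((β : (quasiSplit F E c 3).arithmeticSubgroup)) : (quasiSplit F E c 3).Adelic) *
              (y * g) ∈ tsupport f) ∧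
          ‖truncatedKernel ν 𝓕₀ T f g‖ ≤ R.card * (3 * L * ρ))
    {Ω : Set (quasiSplit F E c 3).Adelic} {R₁ R₂ : Set (AdeleRing (𝓞 E) E)} {C₀ : ℝ≥0}
    (hH4 : ∀ b : borelAdelic F E c 3,
      (((torusPart b)⁻¹ * b : borelAdelic F E c 3) : (quasiSplit F E c 3).Adelic) ∈ Ω →
      (((diagUnit b.2 0)⁻¹ * diagUnit b.2 1 : (AdeleRing (𝓞 E) E)ˣ) : AdeleRing (𝓞 E) E) ∈ R₁ →
      (((diagUnit b.2 0)⁻¹ * diagUnit b.2 2 : (AdeleRing (𝓞 E) E)ˣ) : AdeleRing (𝓞 E) E) ∈ R₂ →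
      ∀ k ∈ (((standardMaximalCompactGL 3 E).comap (adelicVal F E c 3 ((StdForm.antidiagonal 3).over E)) :
          Subgroup (quasiSplit F E c 3).Adelic) : Set (quasiSplit F E c 3).Adelic),
        ∀ R : Finset (arithmeticBorel F E c 3),
        (∀ β ∈ R, ∃ y ∈ insert (1 : adelicUnipotent F E c 3) W₀, ((b : (quasiSplit F E c 3).Adelic) * k)⁻¹ *
          (((β : (quasiSplit F E c 3).arithmeticSubgroup)) : (quasiSplit F E c 3).Adelic) *
          ((y : (quasiSplit F E c 3).Adelic) * ((b : (quasiSplit F E c 3).Adelic) * k)) ∈ tsupport f) →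
        (R.card : ℝ≥0∞) * ν 𝓕₀ ≤ (C₀ : ℝ≥0∞) * ((torusRootModulus E 3 (diagUnit b.2) : ℝ≥0) : ℝ≥0∞))
    {c₀ : ℝ≥0} (hc₀ : ∀ g : (quasiSplit F E c 3).Adelic, c₀ < borelHeight g → kernel f g g = borelSum f g g)
    {S : Set (borelAdelic F E c 3)} {T₀ : ℝ≥0}
    (hSred : ∀ b ∈ S, T₀ < borelHeight (b : (quasiSplit F E c 3).Adelic) →
      (((torusPart b)⁻¹ * b : borelAdelic F E c 3) : (quasiSplit F E c 3).Adelic) ∈ Ω ∧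
      (((diagUnit b.2 0)⁻¹ * diagUnit b.2 1 : (AdeleRing (𝓞 E) E)ˣ) : AdeleRing (𝓞 E) E) ∈ R₁ ∧
      (((diagUnit b.2 0)⁻¹ * diagUnit b.2 2 : (AdeleRing (𝓞 E) E)ˣ) : AdeleRing (𝓞 E) E) ∈ R₂)
    {ρ : borelAdelic F E c 3 → ℝ}
    (hgeom : ∀ b ∈ S, T₀ < borelHeight (b : (quasiSplit F E c 3).Adelic) →
      ∀ k : (quasiSplit F E c 3).Adelic,
      adelicVal F E c 3 ((StdForm.antidiagonal 3).over E) k ∈ standardMaximalCompactGL 3 E →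
      ∀ u ∈ 𝓕₀, ∃ (t₁ t₂ t₃ : ℝ) (X₁ X₂ X₃ : Matrix (Fin 3) (Fin 3) (mixedSpace E))
        (w : GL (Fin 3) (AdeleRing (𝓞 E) E)),
      X₁ ∈ S_dir ∧ X₂ ∈ S_dir ∧ X₃ ∈ S_dir ∧ w ∈ U ∧ |t₁| ≤ ρ b ∧ |t₂| ≤ ρ b ∧ |t₃| ≤ ρ b ∧
      adelicVal F E c 3 _ ((((b : (quasiSplit F E c 3).Adelic) * k)⁻¹ *
          (u : (quasiSplit F E c 3).Adelic) * ((b : (quasiSplit F E c 3).Adelic) * k))) =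
        GLn.ofInfinite 3 E (expGL (t₁ • X₁) * expGL (t₂ • X₂) * expGL (t₃ • X₃)) * w)
    (hH10 : ∀ T : ℝ≥0, T₀ < T →
      ∫⁻ b in S ∩ {b | T < borelHeight (b : (quasiSplit F E c 3).Adelic)},
        ((torusRootModulus E 3 (diagUnit b.2) : ℝ≥0) : ℝ≥0∞) * ENNReal.ofReal (ρ b) ∂μB < ∞)
    {T : ℝ≥0} (hT : max (max 1 c₀) T₀ < T) :
    ∃ Φ : borelAdelic F E c 3 → ℝ≥0∞,
      (∀ b ∈ S, ∀ k : (quasiSplit F E c 3).Adelic,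
        adelicVal F E c 3 ((StdForm.antidiagonal 3).over E) k ∈ standardMaximalCompactGL 3 E →
        T < borelHeight (b : (quasiSplit F E c 3).Adelic) →
        (‖kernel f ((b : (quasiSplit F E c 3).Adelic) * k) ((b : (quasiSplit F E c 3).Adelic) * k) -
            kernelBorel ν 𝓕 f ((b : (quasiSplit F E c 3).Adelic) * k)
              ((b : (quasiSplit F E c 3).Adelic) * k)‖ₑ : ℝ≥0∞) ≤ Φ b) ∧
      ∫⁻ b in S ∩ {b | T < borelHeight (b : (quasiSplit F E c 3).Adelic)}, Φ b ∂μB < ∞ := by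
  have hT1 : 1 ≤ T := ((le_max_left _ _).trans (le_max_left _ _)).trans hT.le
  have hTc₀ : c₀ ≤ T := ((le_max_right _ _).trans (le_max_left _ _)).trans hT.le
  have hT₀ : T₀ < T := lt_of_le_of_lt (le_max_right _ _) hT
  refine ⟨fun b => (C₀ : ℝ≥0∞) * (ν 𝓕₀)⁻¹ * ENNReal.ofReal (3 * L) *
      (((torusRootModulus E 3 (diagUnit b.2) : ℝ≥0) : ℝ≥0∞) * ENNReal.ofReal (ρ b)),
    fun b hb k hk hTb => ?_, ?_⟩
  · have hred := hSred b hb (lt_trans hT₀ hTb)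
    exact enorm_kernel_sub_kernelBorel_le_majorant ν h𝓕 h𝓕₀ hW₀ h𝓕₀W₀ hL hH5 hH4 hc₀ hT1 hTc₀
      hred.1 hred.2.1 hred.2.2 hk hTb (hgeom b hb (lt_trans hT₀ hTb) k hk)
  · have hν0 : ν 𝓕₀ ≠ 0 := measure_ne_zero_of_isFundamentalDomain ν h𝓕₀
    have hK : (C₀ : ℝ≥0∞) * (ν 𝓕₀)⁻¹ * ENNReal.ofReal (3 * L) ≠ ⊤ :=
      ENNReal.mul_ne_top (ENNReal.mul_ne_top ENNReal.coe_ne_top (ENNReal.inv_ne_top.2 hν0))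
        ENNReal.ofReal_ne_top
    rw [lintegral_const_mul' _ _ hK]
    exact ENNReal.mul_lt_top hK.lt_top (hH10 T hT₀)

end Rows

/-! ## §3 `TruncatedKernelIntegrable` from the rows -/

/-- **`TruncatedKernelIntegrable F E c` FROM THE ROWS** (generic CM-like pair; `hc`, `hc1`, unimodularity and
the adelic Iwasawa decomposition `hBK` as hypotheses).  Beyond the landed heads (★ H3 × H5a × H5c
`IsQuasiSplitTest.exists_level_norm_truncatedKernel_le`, ★ H4-d, ★ Siegel property, ★ `k^T = K − K_B`, ★ H8b),
the input is the ROW PACKAGE `hrows`, per Haar measure `ν` of `N(𝔸_F)`: a left Haar measure `μ_B` of `B(𝔸)`,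
a Siegel set `S ⊆ B(𝔸)` — closed, `B(𝔸) ∩ K_U`-saturated, with `B(F) · S · K_U = G(𝔸)`, REDUCED above height
`T₀` into compacta `Ω, R₁, R₂` (row H9b) — and, for every admissible level `U`, a fundamental domain
`𝓕₀ ⊆ W₀` (compact) of `N(F)` with the three-factor geometry of `Ad((bk)⁻¹) u` at scale `ρ(b)` along the
compact direction set `S_dir` (row H5b) whose weight `δ_B · ρ` is integrable on `S ∩ {H > T}` (row H10).
[cite: Arthur1978TraceFormulaI, §8 (pp. 947–950)] [cite: Rogawski1990, §2.2 (p. 13)] -/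
theorem truncatedKernelIntegrable_of_rows (hc : c * c = 1) (hc1 : c ≠ 1)
    (hunimod : ∀ [MeasurableSpace (quasiSplit F E c 3).Adelic] [BorelSpace (quasiSplit F E c 3).Adelic]
      (νG : Measure (quasiSplit F E c 3).Adelic), νG.IsHaarMeasure → νG.IsMulRightInvariant)
    (hBK : ∀ g : (quasiSplit F E c 3).Adelic, ∃ b ∈ borelAdelic F E c 3, ∃ k : (quasiSplit F E c 3).Adelic,
      adelicVal F E c 3 ((StdForm.antidiagonal 3).over E) k ∈ standardMaximalCompactGL 3 E ∧ g = b * k)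
    {S_dir : Set (Matrix (Fin 3) (Fin 3) (mixedSpace E))} (hSdir : IsCompact S_dir)
    (hrows : ∀ [MeasurableSpace (adelicUnipotent F E c 3)] [BorelSpace (adelicUnipotent F E c 3)]
      [MeasurableSpace (quasiSplit F E c 3).Adelic] [BorelSpace (quasiSplit F E c 3).Adelic]
      (ν : Measure (adelicUnipotent F E c 3)) [ν.IsHaarMeasure],
      ∃ (μB : Measure (borelAdelic F E c 3)) (_ : μB.IsHaarMeasure) (S : Set (borelAdelic F E c 3))
        (Ω : Set (quasiSplit F E c 3).Adelic) (R₁ R₂ : Set (AdeleRing (𝓞 E) E)) (T₀ : ℝ≥0),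
        IsClosed S ∧
        (∀ b ∈ S, ∀ k : borelAdelic F E c 3,
          adelicVal F E c 3 ((StdForm.antidiagonal 3).over E) (k : (quasiSplit F E c 3).Adelic) ∈
            standardMaximalCompactGL 3 E → b * k ∈ S) ∧
        (∀ g : (quasiSplit F E c 3).Adelic, ∃ β : (quasiSplit F E c 3).arithmeticSubgroup,
          β ∈ arithmeticBorel F E c 3 ∧ ∃ b ∈ S, ∃ k : (quasiSplit F E c 3).Adelic,
            adelicVal F E c 3 ((StdForm.antidiagonal 3).over E) k ∈ standardMaximalCompactGL 3 E ∧
            (β : (quasiSplit F E c 3).Adelic) * g = (b : (quasiSplit F E c 3).Adelic) * k) ∧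
        IsCompact Ω ∧ IsCompact R₁ ∧ IsCompact R₂ ∧
        (∀ b ∈ S, T₀ < borelHeight (b : (quasiSplit F E c 3).Adelic) →
          (((torusPart b)⁻¹ * b : borelAdelic F E c 3) : (quasiSplit F E c 3).Adelic) ∈ Ω ∧
          (((diagUnit b.2 0)⁻¹ * diagUnit b.2 1 : (AdeleRing (𝓞 E) E)ˣ) : AdeleRing (𝓞 E) E) ∈ R₁ ∧
          (((diagUnit b.2 0)⁻¹ * diagUnit b.2 2 : (AdeleRing (𝓞 E) E)ˣ) : AdeleRing (𝓞 E) E) ∈ R₂) ∧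
        ∀ U ∈ finiteLevelsGL 3 E, ∃ (𝓕₀ W₀ : Set (adelicUnipotent F E c 3)) (ρ : borelAdelic F E c 3 → ℝ),
          IsFundamentalDomain (rationalUnipotent F E c 3) 𝓕₀ ν ∧ IsCompact W₀ ∧ 𝓕₀ ⊆ W₀ ∧
          (∀ b ∈ S, T₀ < borelHeight (b : (quasiSplit F E c 3).Adelic) →
            ∀ k : (quasiSplit F E c 3).Adelic,
            adelicVal F E c 3 ((StdForm.antidiagonal 3).over E) k ∈ standardMaximalCompactGL 3 E →
            ∀ u ∈ 𝓕₀, ∃ (t₁ t₂ t₃ : ℝ) (X₁ X₂ X₃ : Matrix (Fin 3) (Fin 3) (mixedSpace E))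
              (w : GL (Fin 3) (AdeleRing (𝓞 E) E)),
            X₁ ∈ S_dir ∧ X₂ ∈ S_dir ∧ X₃ ∈ S_dir ∧ w ∈ U ∧ |t₁| ≤ ρ b ∧ |t₂| ≤ ρ b ∧ |t₃| ≤ ρ b ∧
            adelicVal F E c 3 _ ((((b : (quasiSplit F E c 3).Adelic) * k)⁻¹ *
                (u : (quasiSplit F E c 3).Adelic) * ((b : (quasiSplit F E c 3).Adelic) * k))) =
              GLn.ofInfinite 3 E (expGL (t₁ • X₁) * expGL (t₂ • X₂) * expGL (t₃ • X₃)) * w) ∧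
          (∀ T : ℝ≥0, T₀ < T →
            ∫⁻ b in S ∩ {b | T < borelHeight (b : (quasiSplit F E c 3).Adelic)},
              ((torusRootModulus E 3 (diagUnit b.2) : ℝ≥0) : ℝ≥0∞) * ENNReal.ofReal (ρ b) ∂μB < ∞)) :
    TruncatedKernelIntegrable F E c := by
  refine truncatedKernelIntegrable_of_majorant_maximalCompact hc hunimod hBK ?_
  intro mU bU mG bG νG hνG ν hν 𝓕 h𝓕 f hf
  obtain ⟨μB, hμB, S, Ω, R₁, R₂, T₀, hSc, hSK, hcov, hΩ, hR₁, hR₂, hSred, hU⟩ := hrows ν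
  have hfs : HasCompactSupport f := hf.hasCompactSupport'
  -- rows H3 × H5a × H5c: the level `U` and the Lipschitz constant `L` of `f` along `S_dir`
  obtain ⟨U, hUmem, L, hL, hH5⟩ := hf.exists_level_norm_truncatedKernel_le hSdir
  -- rows H5b and H10 at this level
  obtain ⟨𝓕₀, W₀, ρ, h𝓕₀, hW₀, h𝓕₀W₀, hgeom, hH10⟩ := hU U hUmem
  -- row H4-d: the cell count on the reduced set, and the Siegel constant `c₀`
  obtain ⟨C₀, hH4⟩ := exists_forall_card_mul_measure_le_mul_torusRootModulus hc hc1 ν h𝓕₀ hW₀ h𝓕₀W₀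
    (hW₀.insert 1) (C := tsupport f) hfs
    (isCompact_comap_adelicVal_standardMaximalCompactGL (F := F) (E := E) (c := c) (N := 3)) hΩ hR₁ hR₂
  obtain ⟨c₀, hc₀⟩ := exists_kernel_eq_borelSum_of_lt_borelHeight (c := c) hfs
  refine ⟨max (max 1 c₀) T₀, fun T hT => ?_⟩
  obtain ⟨Φ, hest, hΦ⟩ := exists_majorant_of_rows ν h𝓕 h𝓕₀ hW₀ h𝓕₀W₀ μB hL
    (fun {T'} hT' {g} hg hK ρ' hge => hH5 ν h𝓕₀ hW₀ h𝓕₀W₀ hT' hg hK ρ' hge) hH4 hc₀ hSred hgeom hH10 hT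
  exact ⟨μB, hμB, S, Φ, hSc, hSK, hcov, hest, hΦ⟩

/-- **`TruncatedKernelIntegrable L⁺ L c` FROM THE ROWS, AT A CM EXTENSION** — `hc`, `hc1`, unimodularity
(★ `isMulRightInvariant_quasiSplit_cm_three`) and the adelic Iwasawa decomposition (★
`exists_mem_borelAdelic_mul_mem_standardMaximalCompactGL_cm_three`, row H6b-i) DISCHARGED: the T1-qs named
fact for the line's `G = U(Φ₃)` follows from the row package `hrows` (rows H9b, H5b, H10) alone.
[cite: Arthur1978TraceFormulaI, §8 (pp. 947–950)] [cite: Rogawski1990, §2.2 (p. 13)] -/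
theorem truncatedKernelIntegrable_cm_of_rows (L : Type) [Field L] [NumberField L] [IsCMField L]
    {S_dir : Set (Matrix (Fin 3) (Fin 3) (mixedSpace L))} (hSdir : IsCompact S_dir)
    (hrows : ∀ [MeasurableSpace (adelicUnipotent (↥(maximalRealSubfield L)) L (IsCMField.complexConj L) 3)]
      [BorelSpace (adelicUnipotent (↥(maximalRealSubfield L)) L (IsCMField.complexConj L) 3)]
      [MeasurableSpace (quasiSplit (↥(maximalRealSubfield L)) L (IsCMField.complexConj L) 3).Adelic]
      [BorelSpace (quasiSplit (↥(maximalRealSubfield L)) L (IsCMField.complexConj L) 3).Adelic]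
      (ν : Measure (adelicUnipotent (↥(maximalRealSubfield L)) L (IsCMField.complexConj L) 3))
      [ν.IsHaarMeasure],
      ∃ (μB : Measure (borelAdelic (↥(maximalRealSubfield L)) L (IsCMField.complexConj L) 3))
        (_ : μB.IsHaarMeasure)
        (S : Set (borelAdelic (↥(maximalRealSubfield L)) L (IsCMField.complexConj L) 3))
        (Ω : Set (quasiSplit (↥(maximalRealSubfield L)) L (IsCMField.complexConj L) 3).Adelic)
        (R₁ R₂ : Set (AdeleRing (𝓞 L) L)) (T₀ : ℝ≥0),
        IsClosed S ∧
        (∀ b ∈ S, ∀ k : borelAdelic (↥(maximalRealSubfield L)) L (IsCMField.complexConj L) 3,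
          adelicVal (↥(maximalRealSubfield L)) L (IsCMField.complexConj L) 3 ((StdForm.antidiagonal 3).over L)
            (k : (quasiSplit (↥(maximalRealSubfield L)) L (IsCMField.complexConj L) 3).Adelic) ∈
            standardMaximalCompactGL 3 L → b * k ∈ S) ∧
        (∀ g : (quasiSplit (↥(maximalRealSubfield L)) L (IsCMField.complexConj L) 3).Adelic,
          ∃ β : (quasiSplit (↥(maximalRealSubfield L)) L (IsCMField.complexConj L) 3).arithmeticSubgroup,
          β ∈ arithmeticBorel (↥(maximalRealSubfield L)) L (IsCMField.complexConj L) 3 ∧ ∃ b ∈ S,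
          ∃ k : (quasiSplit (↥(maximalRealSubfield L)) L (IsCMField.complexConj L) 3).Adelic,
            adelicVal (↥(maximalRealSubfield L)) L (IsCMField.complexConj L) 3 ((StdForm.antidiagonal 3).over L) k ∈
              standardMaximalCompactGL 3 L ∧
            (β : (quasiSplit (↥(maximalRealSubfield L)) L (IsCMField.complexConj L) 3).Adelic) * g =
              (b : (quasiSplit (↥(maximalRealSubfield L)) L (IsCMField.complexConj L) 3).Adelic) * k) ∧
        IsCompact Ω ∧ IsCompact R₁ ∧ IsCompact R₂ ∧
        (∀ b ∈ S, T₀ < borelHeight (b : (quasiSplit (↥(maximalRealSubfield L)) L (IsCMField.complexConj L) 3).Adelic) →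
          (((torusPart b)⁻¹ * b : borelAdelic (↥(maximalRealSubfield L)) L (IsCMField.complexConj L) 3) :
              (quasiSplit (↥(maximalRealSubfield L)) L (IsCMField.complexConj L) 3).Adelic) ∈ Ω ∧
          (((diagUnit b.2 0)⁻¹ * diagUnit b.2 1 : (AdeleRing (𝓞 L) L)ˣ) : AdeleRing (𝓞 L) L) ∈ R₁ ∧
          (((diagUnit b.2 0)⁻¹ * diagUnit b.2 2 : (AdeleRing (𝓞 L) L)ˣ) : AdeleRing (𝓞 L) L) ∈ R₂) ∧
        ∀ U ∈ finiteLevelsGL 3 L,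
          ∃ (𝓕₀ W₀ : Set (adelicUnipotent (↥(maximalRealSubfield L)) L (IsCMField.complexConj L) 3))
            (ρ : borelAdelic (↥(maximalRealSubfield L)) L (IsCMField.complexConj L) 3 → ℝ),
          IsFundamentalDomain (rationalUnipotent (↥(maximalRealSubfield L)) L (IsCMField.complexConj L) 3) 𝓕₀ ν ∧
          IsCompact W₀ ∧ 𝓕₀ ⊆ W₀ ∧
          (∀ b ∈ S, T₀ < borelHeight (b : (quasiSplit (↥(maximalRealSubfield L)) L (IsCMField.complexConj L) 3).Adelic) →
            ∀ k : (quasiSplit (↥(maximalRealSubfield L)) L (IsCMField.complexConj L) 3).Adelic,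
            adelicVal (↥(maximalRealSubfield L)) L (IsCMField.complexConj L) 3 ((StdForm.antidiagonal 3).over L) k ∈
              standardMaximalCompactGL 3 L →
            ∀ u ∈ 𝓕₀, ∃ (t₁ t₂ t₃ : ℝ) (X₁ X₂ X₃ : Matrix (Fin 3) (Fin 3) (mixedSpace L))
              (w : GL (Fin 3) (AdeleRing (𝓞 L) L)),
            X₁ ∈ S_dir ∧ X₂ ∈ S_dir ∧ X₃ ∈ S_dir ∧ w ∈ U ∧ |t₁| ≤ ρ b ∧ |t₂| ≤ ρ b ∧ |t₃| ≤ ρ b ∧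
            adelicVal (↥(maximalRealSubfield L)) L (IsCMField.complexConj L) 3 _
                ((((b : (quasiSplit (↥(maximalRealSubfield L)) L (IsCMField.complexConj L) 3).Adelic) * k)⁻¹ *
                  (u : (quasiSplit (↥(maximalRealSubfield L)) L (IsCMField.complexConj L) 3).Adelic) *
                  ((b : (quasiSplit (↥(maximalRealSubfield L)) L (IsCMField.complexConj L) 3).Adelic) * k))) =
              GLn.ofInfinite 3 L (expGL (t₁ • X₁) * expGL (t₂ • X₂) * expGL (t₃ • X₃)) * w) ∧
          (∀ T : ℝ≥0, T₀ < T →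
            ∫⁻ b in S ∩ {b | T < borelHeight
                (b : (quasiSplit (↥(maximalRealSubfield L)) L (IsCMField.complexConj L) 3).Adelic)},
              ((torusRootModulus L 3 (diagUnit b.2) : ℝ≥0) : ℝ≥0∞) * ENNReal.ofReal (ρ b) ∂μB < ∞)) :
    TruncatedKernelIntegrable (↥(maximalRealSubfield L)) L (IsCMField.complexConj L) :=
  truncatedKernelIntegrable_of_rows (complexConj_mul_complexConj L) (IsCMField.complexConj_ne_one L)
    (forall_isHaarMeasure_isMulRightInvariant_quasiSplit_cm_three L)
    (exists_mem_borelAdelic_mul_mem_standardMaximalCompactGL_cm_three L) hSdir hrows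

end UnitaryGroup

end Literature.NumberTheory.Automorphic
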